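import Literature.AlgebraicGeometry.ShimuraVarieties.UnitaryShimuraCanonicalModel
import Literature.NumberTheory.Automorphic.UnitaryGroupDirectSumCarriersFinite
import Literature.NumberTheory.Automorphic.UnitaryGroupLevelTransport
import HarnessLib

/-!
# The canonical model of the unitary Shimura CURVE `Sh(U(J⋆), 𝔻)` — carriers and record (the geometric seesaw source)

For a CM field `L` (maximal totally real subfield `L⁺`, involution `c`), a hermitian Gram matrix `J⋆ ∈ M₂(L)` (signature
`(1,1)` at a complex embedding `τ`, definite at the embeddings off the place of `τ`) this file TYPES — as DEFINITIONS WITH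
BODIES over the tree's carriers, with NO named fact, NO instance, NO `sorry` — the objects through which the canonical model of
the Shimura CURVE of the datum

  `Gₛ := Res_{L⁺/ℚ} U(J⋆)`,  `hₛ := h_{V⋆,τ̄}`,  `𝔻 = {negative lines of J⋆^τ in ℂ²}`

is spoken about: the rank-2 copy of the rank-3 file `UnitaryShimuraCanonicalModel.lean` (same directory, same conventions,
same docstring architecture; its `ShimuraSet` (in `AdelicDoubleQuotientDissection`), `IsDiagTwist`, `Record` :228 and
`RecordSystem` :308 are transcribed with `3 ↦ 2`, in CONE coordinates).  This is the SOURCE of the sub-Shimura datum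
`G⋆ ↪ G` of the proof of [Liu2021, Thm. 4.15] («For every orthogonal decomposition `V = V⋆ ⊕ V⋆^⊥` of hermitian spaces such
that `V⋆^⊥` is totally positive definite, we have similarly the Shimura variety `Sh(G⋆, h⋆)` together with the morphism
`Sh(G⋆, h⋆) → Sh(G, h)` over `E`», FJcycle.tex l. 2193, print pp. 50–51; `G⋆ = Res U(V⋆)` ALONE: «the map
`𝒞^∞(G(ℚ)\G(𝔸), ℂ) → 𝒞^∞(G⋆(ℚ)\G⋆(𝔸), ℂ)` induced by the inclusion `G⋆ ↪ G`», l. 2199, `g⋆` acting on the `V⋆`-variable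
only, l. 2203–2208) = the curve case of App. D (l. 5355, print p. 130: «`V` … of rank 2 of signature `(1,1)` at `τ₁` and
`(2,0)` elsewhere … Shimura varieties `{Sh(G,h)_K}` defined over `E` … smooth curves over `E`»), in the shape in which the
registered `a3_liu418` skeleton of the cell `hodgecm-mathlib` PINS its seesaw sources (`SeesawSource.lean`; pin decision P′
of the 24832 pen, 2026-08-28T16:20:56Z: `eG : Gₛ ≃ₜ* U(J⋆)(𝔸_{F⁺,f})`, `φ_pin : φ (eG.symm u) = R_B (u ⊕ᶠ 1)`; A-plan2's
elaborated sketch 0abc7b72).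

## Contents

* §1 `ratToGLℂ τ : U(J⋆)(L⁺) →* GL₂(ℂ)`, `γ ↦ γ^τ` (over ★ `UnitaryGroup.rational … 2 J⋆`).
* §2 `ShimuraSetGS τ K = U(J⋆)(L⁺) \ [𝔻 × U(J⋆)(𝔸_{L⁺,f})/K]` for ANY subgroup `K ≤ U(J⋆)(𝔸_{L⁺,f})` (★ `UnitaryGroup.finAdelic … 2 J⋆`),
  as the quotient of `negCone(J⋆^τ) × U(J⋆)(𝔸_f)/K` by the hand-written relation `gsRel` («`c · γ^τ v′ = v` and `γ a′K = aK` for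
  some `γ ∈ U(J⋆)(L⁺)`, `c ∈ ℂˣ`»; proved an equivalence), with `mk`, `mk_surjective`, `mk_eq_mk_iff`, `mk_smul_mulVec` — the
  pattern of ★ `ModuliOfAbelianVarieties.SiegelShimuraSet` (no instance; an `abbrev` of a `Quotient`, so the quotient TOPOLOGY
  applies and `pts` below is a homeomorphism as in rank 3).  DISC IN CONE COORDINATES: a point of `𝔻` is a negative vector of
  `J⋆^τ` up to `ℂˣ` (the tree's `negCone`, as in `UnitaryBallUniformisationDatum p`, here `p = 1`); no `Ball`/`U(1,1)`-model file
  is used or needed (the rank-3 `ShimuraSet` goes through the frame `T` and `U21`; at rank 2 the cone is the shorter road).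
* §3 the CM pairs: `adelicVecFin` and `IsDiagTwistGS` (rank-2 copy of ★ `IsDiagTwist`: `d ∈ U(J⋆)(𝔸_f)` multiplies the
  `L`-rational negative vector `w` by `t` and fixes `w^⊥`).
* §4 `RecordGS τ K` (one level) and `RecordSystemGS τ K₀` (functor on `C5.SmallLevel K₀`, `K₀` open compact in `U(J⋆)(𝔸_f)`)
  with fields `M / smooth (rel. dim 1) / projective / pts / [map_pts] / hol / pieces / recip`, and `RecordSystemGS.record`.
* §5 `φGS = R_B ∘ blockdiag ∘ (·, 1) : U(J⋆)(𝔸_f) →* U(H)(𝔸_f)` (★ `finAdelicCongr` ∘ ★ `finAdelicBlockDiag` ∘ `MonoidHom.inl`)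
  for a frame `ᵗ(cB)(a·H)B = J⋆ ⊕ J⊥` with `J⊥ ∈ M₁(L)`, and `continuous_φGS` — the `φ` of the skeleton's re-pinned `FacePinData`
  with `eG := refl`, `φ_pin := rfl` (`a := 1`).
* §6 bookkeeping: `U(J⋆)(L⁺)` acts on `ℂ²` by isometries of `J⋆^τ` (`conjTranspose_ratToGLℂ_mul`), `U(J⋆)(L⁺) × ℂˣ` preserves
  the negative cone (`smul_ratToGLℂ_mulVec_mem_negCone`), and the action is packaged as a `MulAction` DEFINITION `coneActionGS`
  (NOT an instance; bind with `letI` where the tree's generic `ShimuraDissection` is wanted — its stabiliser of `gK` is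
  `Γ_{gKg⁻¹} × ℂˣ`, so the pieces are ball quotients of the shape `UnitaryBallUniformisationDatum.ballQuotient`).

## The mathematics recorded by the record (and where it is printed)

(F1) `M_K` is a smooth projective CURVE over `L` (model over the reflex field `τ(L)` — [Liu2021] Rem. C.2 l. 4602–4610, print
p. 108: for signature `(n−1,1)` at one place and `(n,0)` elsewhere «the reflex field of `h_{V,τ'}` is `τ'(E)`», here `n = 2` —
pulled back along `τ`); NOT geometrically connected in general.  (F2a) `pts`: `M_K(ℂ)` along `τ` IS
`Sh_K(ℂ) = U(J⋆)(L⁺) \ [𝔻 × U(J⋆)(𝔸_{L⁺,f})/K]` ([Deligne1979ShimuraVarieties] 2.1.2, 2.2.5; [Milne2005ShimuraVarieties] Lemma 5.13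
p. 57).  (F2b) `hol`: the complex structure is the tautological one of the disc, in the cone-coordinate phrasing of ★
`UnitaryBallUniformisationDatum.differentiableOn_unif`.  (F2c) `pieces`: `(M_K)_τ` is the finite coproduct over
`U(J⋆)(L⁺) \ U(J⋆)(𝔸_f) / K` of compact disc quotients `Γ_q \ 𝔻` of the tree's kind (`UnitaryBallUniformisationDatum 1`),
`Γ_q = U(J⋆)(L⁺) ∩ g_q K g_q⁻¹` (★ `arithmeticLevel … 2 J⋆`; [Deligne1979ShimuraVarieties] 2.1.2 «a disjoint sum, indexed by
`G(ℚ)\G(𝔸^f)/K`, of the quotients `Γ_g\X⁺`»).  (F3) `recip`: Shimura reciprocity [Milne2005ShimuraVarieties] Def. 12.8 (62) p. 114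
at the CM pairs `(T, x)`, `x = [τ w]` the negative line of an `L`-rational `w ∈ L²`, `T = U(L·w) × U(w^⊥)` (a maximal torus of
`U(J⋆)`): for `σ ∈ Aut(ℂ/τL)` and a finite idèle `s` with `art_L(s) = σ|_{L^{ab}}` (★ `IsArtinCorrespondent`,
[Milne2005ShimuraVarieties] (59) p. 107), `σ • [τw, aK] = [τw, d·aK]` with `d = r_x(s)`: ★ `recipFactor L s = c(s)/s` on `w` and `1`
on `w^⊥` ([Deligne1979ShimuraVarieties] 2.2.4 with footnote 44; [Milne2005ShimuraVarieties] (60)–(61) p. 114) — exactly the rank-3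
clause with `v₃ ↦ w`.

> PRINT (for the reading audit).  (1) THE TWIST: the Hodge map of [Liu2021] §C.1 (l. 4583–4596, print pp. 107–108) is
> «`z ↦ (diag(I_{p_{τ_1}}, (z/z̄) I_{q_{τ_1}}), …)`» — identity on every positive summand; at rank 2 the cocharacter `μ_x` of a
> CM pair is `[τ̄] − [τ]` on `U(L·w)` and TRIVIAL on `U(w^⊥)`, so `r_x(s)` is `c(s)/s` on `w` and `1` on `w^⊥` (`IsDiagTwistGS`).
> (2) SOURCE GROUP = `U(J⋆)` ALONE (l. 2199, 2203–2208; App. D l. 5355); the compact factor `U(V⋆^⊥)` of the see-saw enters ONLY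
> through `φGS = R_B ∘ blockdiag ∘ (·, 1)` (§5), not through the Shimura variety.  (3) The relation `gsRel` takes negative VECTORS
> up to `ℂˣ` instead of a disc model: `[v, aK]` depends on the line `ℂv` only (`mk_smul_mulVec` with `γ = 1`).  (4) `(B q).E`, the
> CM subfield of `ℂ` of a piece, is NOT asserted to be `τ(L)`: only the complex form `(B q).Hℂ = J⋆^τ` and the group `τ(Γ_q)` are
> pinned (as in the rank-3 record).  (5) Nothing here asserts EXISTENCE: the corresponding named fact («`exists_recordSystemGS`»,
> [Deligne1979ShimuraVarieties] 2.2.5 + Cor. 2.7.21 for `Res U(J⋆)`, [Milne2005ShimuraVarieties] Thm. 14.15 – Rem. 14.17) is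
> deliberately NOT in this file (debt 0); its hypotheses would be those of ★ `exists_recordSystem` with `3 ↦ 2`.

## What is NOT here

The existence fact (previous paragraph); Hecke translates on the curve and the morphism of towers `Sh(U(J⋆)) → Sh(U(H))` along
`φGS` ([Milne2005ShimuraVarieties] Thm. 13.6 p. 118; the skeleton's `Sec42Data.TowerHom`); the packaging of a `RecordSystemGS` as a
`Liu2021.AppendixC.Sec42Data` with `n = 2` (Albanese data, étale Hecke datum); any statement of [Liu2021] App. D on this curve;
the `p = 1` twin of ★ `UnitaryBallHeckeTranslation` (hard-wired `Fin 3`).  Those are later nodes of the cell's GS programme.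

## References

* [Deligne1979ShimuraVarieties] P. Deligne, *Variétés de Shimura: interprétation modulaire, et techniques de construction de
  modèles canoniques*, PSPM XXXIII.2 (1979) 247–289: 2.1.2–2.1.4, 2.2.4–2.2.5, Cor. 2.7.21 (Milne's translation, PDF pp. 28–29, 51–52).
* [Milne2005ShimuraVarieties] J. S. Milne, *Introduction to Shimura varieties* (2005/2017): §5 (5.1) p. 56, Lemma 5.13 p. 57,
  (59) p. 107, Def. 12.5 p. 113, (60)–(62) Def. 12.8 p. 114, Def. 12.10 p. 115, Thm. 13.6 p. 118.
* [Liu2021] Y. Liu, *Fourier–Jacobi cycles and arithmetic relative trace formula*, Camb. J. Math. 9 (2021) = arXiv:2102.11518,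
  TeX `FJcycle.tex`: §C.1 l. 4575–4610 (print pp. 107–108), Prop. C.5 l. 4627–4633 (p. 109), Thm. 4.15 proof l. 2185–2213 (pp. 50–51),
  App. D l. 5355 (p. 130).
* [Kudla1984] S. Kudla, *Seesaw dual reductive pairs* (1984), §1; [PlatonovRapinchuk1994] §§2.3, 5.1;
  [BergeronMillsonMoeglin2016Balls] Part 2 §§1.1–1.3 (the cone/ball conventions of `UnitaryBallQuotientDatum`).
-/

noncomputable section

open Function MulAction Topology NumberField IsDedekindDomain CategoryTheory Matrix
open scoped Matrix ComplexOrder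
open Literature.AlgebraicGeometry.Motives
open Literature.NumberTheory.Automorphic Literature.NumberTheory.Automorphic.UnitaryGroup
open Literature.NumberTheory.Automorphic.ShimuraDissection
open Literature.NumberTheory.GaloisRepresentations
open Literature.NumberTheory.Automorphic.Liu2021.AppendixC (C5.OpenCompactSubgroup C5.SmallLevel)

namespace Literature.AlgebraicGeometry.ShimuraVarieties

namespace UnitaryCanonicalModel

variable (L : Type) [Field L] [NumberField L] [IsCMField L] (Jstar : Matrix (Fin 2) (Fin 2) L)

/-! ### §1. The source group `Gₛ = U(J⋆)`: its rational points act on `V⋆ ⊗_{L,τ} ℂ = ℂ²` -/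

variable (τ : L →+* ℂ)

/-- `Gₛ(ℚ) = U(J⋆)(L⁺) →* GL₂(ℂ)`, `γ ↦ γ^τ`: the rational points of the source group act on `V⋆ ⊗_{L,τ} ℂ = ℂ²` (entrywise
`τ`; the tree's `UnitaryGroup.rational` at rank `2`).  The source group of the sub-datum of [Liu2021] Thm. 4.15 is `G⋆ = Res U(V⋆)`
ALONE: «the map `𝒞^∞(G(ℚ)\G(𝔸), ℂ) → 𝒞^∞(G⋆(ℚ)\G⋆(𝔸), ℂ)` induced by the inclusion `G⋆ ↪ G`» (l. 2199), `g⋆` acting on the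
`V⋆`-variable only (l. 2203–2208); App. D's `G` is `Res U(V)` for `V` of rank 2 (l. 5355). [cite: Liu2021, Thm. 4.15 proof (FJcycle.tex l. 2193–2208); App. D l. 5355] -/
def ratToGLℂ : ↥(rational (↥(maximalRealSubfield L)) L (IsCMField.complexConj L) 2 Jstar) →* GL (Fin 2) ℂ :=
  (Matrix.GeneralLinearGroup.map τ).comp
    (rational (↥(maximalRealSubfield L)) L (IsCMField.complexConj L) 2 Jstar).subtype

/-- `ratToGLℂ γ` is the matrix `γ` with `τ` applied entrywise. [cite: Liu2021, §C.1 (FJcycle.tex l. 4583–4596)] -/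
theorem coe_ratToGLℂ (γ : ↥(rational (↥(maximalRealSubfield L)) L (IsCMField.complexConj L) 2 Jstar)) :
    ((ratToGLℂ L Jstar τ γ : GL (Fin 2) ℂ) : Matrix (Fin 2) (Fin 2) ℂ) =
      (((γ : ↥(rational (↥(maximalRealSubfield L)) L (IsCMField.complexConj L) 2 Jstar)) : GL (Fin 2) L) : Matrix (Fin 2) (Fin 2) L).map τ :=
  rfl

/-! ### §2. `Sh_K(U(J⋆), 𝔻)(ℂ) = U(J⋆)(L⁺) \ [𝔻 × U(J⋆)(𝔸_{L⁺,f})/K]` on the negative cone of `J⋆^τ` -/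

section ShimuraSet

variable (K : Subgroup ↥(finAdelic (↥(maximalRealSubfield L)) L (IsCMField.complexConj L) 2 Jstar))

/-- The relation «same point of `Sh_K(ℂ)`» on pairs `(v, aK)` of a NEGATIVE vector `v` of `J⋆^τ` (a point of the disc
`𝔻 = {negative lines}` in cone coordinates, the tree's `negCone`) and a coset `aK ∈ U(J⋆)(𝔸_{L⁺,f})/K`: `(v, aK) ∼ (v′, a′K)` iff
`c · γ^τ v′ = v` and `γ a′K = aK` for some `γ ∈ U(J⋆)(L⁺)` and `c ∈ ℂˣ` («`G(ℚ)` acts on `X` and `G(𝔸_f)` on the left,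
`K` on the right», and negative vectors are taken up to `ℂˣ`) — the rank-2 cone-coordinate copy of ★ `ShimuraSet.mk_eq_mk_iff`. [cite: Milne2005ShimuraVarieties, §5 (5.1) p. 56 and Lemma 5.13 p. 57]
[cite: Deligne1979ShimuraVarieties, 2.1.2] -/
def gsRel (x y : ↥(negCone (Jstar.map τ)) × (↥(finAdelic (↥(maximalRealSubfield L)) L (IsCMField.complexConj L) 2 Jstar) ⧸ K)) : Prop :=
  ∃ γ : ↥(rational (↥(maximalRealSubfield L)) L (IsCMField.complexConj L) 2 Jstar), ∃ c : ℂ, c ≠ 0 ∧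
    c • (((ratToGLℂ L Jstar τ γ : GL (Fin 2) ℂ) : Matrix (Fin 2) (Fin 2) ℂ) *ᵥ (y.1 : Fin 2 → ℂ)) =
        (x.1 : Fin 2 → ℂ) ∧
      rationalToFinAdelic (↥(maximalRealSubfield L)) L (IsCMField.complexConj L) 2 Jstar γ • y.2 = x.2

/-- `gsRel` is reflexive (`γ = 1`, `c = 1`). [cite: Milne2005ShimuraVarieties, §5 (5.1) p. 56] -/
theorem gsRel_refl (x : ↥(negCone (Jstar.map τ)) × (↥(finAdelic (↥(maximalRealSubfield L)) L (IsCMField.complexConj L) 2 Jstar) ⧸ K)) : gsRel L Jstar τ K x x :=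
  ⟨1, 1, one_ne_zero, by rw [map_one, Units.val_one, Matrix.one_mulVec, one_smul], by rw [map_one, one_smul]⟩

/-- `gsRel` is symmetric (`γ ↦ γ⁻¹`, `c ↦ c⁻¹`). [cite: Milne2005ShimuraVarieties, §5 (5.1) p. 56] -/
theorem gsRel_symm {x y : ↥(negCone (Jstar.map τ)) × (↥(finAdelic (↥(maximalRealSubfield L)) L (IsCMField.complexConj L) 2 Jstar) ⧸ K)} (h : gsRel L Jstar τ K x y) :
    gsRel L Jstar τ K y x := by
  obtain ⟨γ, c, hc, h1, h2⟩ := h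
  refine ⟨γ⁻¹, c⁻¹, inv_ne_zero hc, ?_, ?_⟩
  · rw [← h1, Matrix.mulVec_smul, Matrix.mulVec_mulVec, map_inv, Units.inv_mul, Matrix.one_mulVec, smul_smul,
      inv_mul_cancel₀ hc, one_smul]
  · rw [← h2, smul_smul, ← map_mul, inv_mul_cancel, map_one, one_smul]

/-- `gsRel` is transitive (`γ γ′`, `c c′`). [cite: Milne2005ShimuraVarieties, §5 (5.1) p. 56] -/
theorem gsRel_trans {x y z : ↥(negCone (Jstar.map τ)) × (↥(finAdelic (↥(maximalRealSubfield L)) L (IsCMField.complexConj L) 2 Jstar) ⧸ K)} (hxy : gsRel L Jstar τ K x y)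
    (hyz : gsRel L Jstar τ K y z) : gsRel L Jstar τ K x z := by
  obtain ⟨γ, c, hc, h1, h2⟩ := hxy
  obtain ⟨γ', c', hc', h1', h2'⟩ := hyz
  refine ⟨γ * γ', c * c', mul_ne_zero hc hc', ?_, ?_⟩
  · rw [← h1, ← h1', Matrix.mulVec_smul, Matrix.mulVec_mulVec, map_mul, Units.val_mul, smul_smul]
  · rw [map_mul, ← smul_smul, h2', h2]

/-- The setoid of `gsRel` on `negCone(J⋆^τ) × U(J⋆)(𝔸_f)/K`. [cite: Milne2005ShimuraVarieties, §5 (5.1) p. 56] -/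
def gsSetoid : Setoid (↥(negCone (Jstar.map τ)) × (↥(finAdelic (↥(maximalRealSubfield L)) L (IsCMField.complexConj L) 2 Jstar) ⧸ K)) where
  r := gsRel L Jstar τ K
  iseqv := ⟨gsRel_refl L Jstar τ K, gsRel_symm L Jstar τ K, gsRel_trans L Jstar τ K⟩

/-- **`Sh_K(U(J⋆), 𝔻)(ℂ) = U(J⋆)(L⁺) \ [𝔻 × U(J⋆)(𝔸_{L⁺,f})/K]`** for the datum `Gₛ = Res_{L⁺/ℚ} U(J⋆)`: the quotient of
`negCone(J⋆^τ) × U(J⋆)(𝔸_f)/K` by `gsRel` (negative vectors up to `ℂˣ` = the disc `𝔻` of negative lines of the signature-`(1,1)`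
form `J⋆^τ`), with the quotient topology (an `abbrev`, so that the `Quotient` instances apply).  For the sub-datum `G⋆ ↪ G` of
[Liu2021] Thm. 4.15 these are the complex points of «the Shimura variety `Sh(G⋆, h⋆)`» (l. 2193) — the rank-2, cone-coordinate copy
of ★ `UnitaryGroup.ShimuraSet`.
[cite: Deligne1979ShimuraVarieties, 2.1.2] [cite: Milne2005ShimuraVarieties, §5 (5.1) p. 56, Lemma 5.13 p. 57]
[cite: Liu2021, Thm. 4.15 proof (FJcycle.tex l. 2193)] -/
abbrev ShimuraSetGS : Type :=
  Quotient (gsSetoid L Jstar τ K)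

/-- The class `[v, aK] ∈ Sh_K(ℂ)` of a negative vector `v` and a finite-adelic point `a ∈ U(J⋆)(𝔸_{L⁺,f})`. [folklore] -/
def ShimuraSetGS.mk (v : Fin 2 → ℂ) (hv : v ∈ negCone (Jstar.map τ)) (a : ↥(finAdelic (↥(maximalRealSubfield L)) L (IsCMField.complexConj L) 2 Jstar)) :
    ShimuraSetGS L Jstar τ K :=
  Quotient.mk (gsSetoid L Jstar τ K) (⟨v, hv⟩, (a : ↥(finAdelic (↥(maximalRealSubfield L)) L (IsCMField.complexConj L) 2 Jstar) ⧸ K))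

/-- Every point of `Sh_K(ℂ)` is a class `[v, aK]`. [cite: Milne2005ShimuraVarieties, Lemma 5.13 p. 57] -/
theorem ShimuraSetGS.mk_surjective :
    ∀ P : ShimuraSetGS L Jstar τ K, ∃ (v : Fin 2 → ℂ) (hv : v ∈ negCone (Jstar.map τ))
      (a : ↥(finAdelic (↥(maximalRealSubfield L)) L (IsCMField.complexConj L) 2 Jstar)), ShimuraSetGS.mk L Jstar τ K v hv a = P := by
  intro P
  induction P using Quotient.inductionOn with | h p => ?_
  obtain ⟨⟨v, hv⟩, q⟩ := p
  induction q using QuotientGroup.induction_on with | H a => ?_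
  exact ⟨v, hv, a, rfl⟩

/-- `[v, aK] = [v′, a′K] ↔ ∃ γ ∈ U(J⋆)(L⁺), ∃ c ∈ ℂˣ, c · γ^τ v′ = v ∧ γ a′K = aK`. [cite: Milne2005ShimuraVarieties, §5 (5.1) p. 56, Lemma 5.13 p. 57] -/
theorem ShimuraSetGS.mk_eq_mk_iff (v v' : Fin 2 → ℂ) (hv : v ∈ negCone (Jstar.map τ)) (hv' : v' ∈ negCone (Jstar.map τ))
    (a a' : ↥(finAdelic (↥(maximalRealSubfield L)) L (IsCMField.complexConj L) 2 Jstar)) :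
    ShimuraSetGS.mk L Jstar τ K v hv a = ShimuraSetGS.mk L Jstar τ K v' hv' a' ↔
      ∃ γ : ↥(rational (↥(maximalRealSubfield L)) L (IsCMField.complexConj L) 2 Jstar), ∃ c : ℂ, c ≠ 0 ∧
        c • (((ratToGLℂ L Jstar τ γ : GL (Fin 2) ℂ) : Matrix (Fin 2) (Fin 2) ℂ) *ᵥ v') = v ∧
          rationalToFinAdelic (↥(maximalRealSubfield L)) L (IsCMField.complexConj L) 2 Jstar γ • (a' : ↥(finAdelic (↥(maximalRealSubfield L)) L (IsCMField.complexConj L) 2 Jstar) ⧸ K) = (a : ↥(finAdelic (↥(maximalRealSubfield L)) L (IsCMField.complexConj L) 2 Jstar) ⧸ K) :=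
  Quotient.eq (r := gsSetoid L Jstar τ K)

/-- **`U(J⋆)(L⁺) × ℂˣ`-invariance of the class**: `[c · γ^τ v, γ a K] = [v, aK]`. [cite: Milne2005ShimuraVarieties, §5 (5.1) p. 56] -/
theorem ShimuraSetGS.mk_smul_mulVec (γ : ↥(rational (↥(maximalRealSubfield L)) L (IsCMField.complexConj L) 2 Jstar)) {c : ℂ} (hc : c ≠ 0) (v : Fin 2 → ℂ)
    (hv : v ∈ negCone (Jstar.map τ))
    (hγv : c • (((ratToGLℂ L Jstar τ γ : GL (Fin 2) ℂ) : Matrix (Fin 2) (Fin 2) ℂ) *ᵥ v) ∈ negCone (Jstar.map τ))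
    (a : ↥(finAdelic (↥(maximalRealSubfield L)) L (IsCMField.complexConj L) 2 Jstar)) :
    ShimuraSetGS.mk L Jstar τ K _ hγv ((rationalToFinAdelic (↥(maximalRealSubfield L)) L (IsCMField.complexConj L) 2 Jstar γ : ↥(finAdelic (↥(maximalRealSubfield L)) L (IsCMField.complexConj L) 2 Jstar)) * a) =
      ShimuraSetGS.mk L Jstar τ K v hv a := by
  rw [ShimuraSetGS.mk_eq_mk_iff]
  exact ⟨γ, c, hc, rfl, rfl⟩

end ShimuraSet

/-! ### §3. The CM pairs: the twist `d = r_x(s)` (`c(s)/s` on the negative `L`-line, `1` on its complement) -/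

/-- A vector of `Lⁿ` regarded in `(𝔸_{L,f})ⁿ` (the rank-generic form of the tree's `adelicVec`). [folklore] -/
def adelicVecFin {n : ℕ} (v : Fin n → L) : Fin n → FiniteAdeleRing (𝓞 L) L :=
  fun i => algebraMap L (FiniteAdeleRing (𝓞 L) L) (v i)

/-- **The twist of a CM pair** `(T, x)` of the curve datum: `d ∈ U(J⋆)(𝔸_{L⁺,f})` multiplies the `L`-rational vector
`w ∈ L²` (whose `τ`-image spans the NEGATIVE line `x`) by `t` and fixes the `J⋆`-orthogonal complement `w^⊥` — the element
`r_x(s) ∈ T(𝔸_f)` of [Milne2005ShimuraVarieties] (60)–(62) p. 114 for the maximal torus `T = U(L·w) × U(w^⊥) ⊂ U(J⋆)` and the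
cocharacter `μ_x`, which is `[τ̄] − [τ]` on `U(L·w)` and TRIVIAL on `U(w^⊥)` (the Hodge map of [Liu2021] §C.1 l. 4583–4596 is
`diag(I_p, (z/z̄) I_q)`: identity on the positive summand); the rank-2 copy of the tree's rank-3 `IsDiagTwist` (`v₃ ↦ w`).
[cite: Milne2005ShimuraVarieties, Def. 12.5 p. 113 and (60)–(62) p. 114] [cite: Deligne1979ShimuraVarieties, 2.2.4]
[cite: Liu2021, §C.1 (FJcycle.tex l. 4583–4596) and Rem. C.2 l. 4604–4608] -/
def IsDiagTwistGS (w : Fin 2 → L) (t : FiniteAdeleRing (𝓞 L) L)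
    (d : finAdelic (↥(maximalRealSubfield L)) L (IsCMField.complexConj L) 2 Jstar) : Prop :=
  ((d : GL (Fin 2) (FiniteAdeleRing (𝓞 L) L)) : Matrix (Fin 2) (Fin 2) (FiniteAdeleRing (𝓞 L) L)) *ᵥ
      adelicVecFin L w = t • adelicVecFin L w ∧
    ∀ w' : Fin 2 → L, hermForm (cmConjRingHom L) Jstar w' w = 0 →
      ((d : GL (Fin 2) (FiniteAdeleRing (𝓞 L) L)) : Matrix (Fin 2) (Fin 2) (FiniteAdeleRing (𝓞 L) L)) *ᵥ
        adelicVecFin L w' = adelicVecFin L w'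

/-! ### §4. The records: a model of `Sh_K(U(J⋆))` over `L`, canonical at the CM pairs; the projective system below `K₀` -/

section Record

variable (K : Subgroup ↥(finAdelic (↥(maximalRealSubfield L)) L (IsCMField.complexConj L) 2 Jstar))

/-- **Deligne's canonical model of the unitary Shimura CURVE `Sh_K(U(J⋆), 𝔻)` at one level `K`, as a record over the tree's
carriers** — the rank-2 copy of the rank-3 `UnitaryCanonicalModel.Record` (same file lineage, same conventions): for the datum
`Gₛ = Res_{L⁺/ℚ} U(J⋆)` with Hodge map `h_{V⋆,τ̄}` ([Liu2021] §C.1 l. 4583–4596: `(z/z̄)` on the negative line, identity on the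
positive one), reflex field `τ(L)` (Rem. C.2), model regarded over `L` along `τ`: (F1) a smooth projective `L`-scheme `M` of
relative dimension `1` (a CURVE — [Liu2021] App. D l. 5355 «smooth curves over `E`» — not assumed geometrically connected: its
complex fibre has `#(U(J⋆)(L⁺) \ U(J⋆)(𝔸_f) / K)` components); (F2a) `pts`: its complex points along `τ` ARE `Sh_K(ℂ) =
U(J⋆)(L⁺) \ [𝔻 × U(J⋆)(𝔸_f)/K]` ([Deligne1979ShimuraVarieties] 2.1.2, 2.2.5; [Milne2005ShimuraVarieties] Lemma 5.13); (F2b) `hol`: the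
complex structure is the TAUTOLOGICAL one on the disc of negative lines of `J⋆^τ`, stated in cone coordinates exactly as the clause
`differentiableOn_unif` of the tree's `UnitaryBallUniformisationDatum`, for the `ℂ`-scheme `M_τ = M ⊗_{L,τ} ℂ`; (F2c) `pieces`: `M_τ` is
the finite coproduct over `U(J⋆)(L⁺) \ U(J⋆)(𝔸_f) / K` of compact DISC quotients of the tree's kind (`UnitaryBallUniformisationDatum 1`) by
the natural levels `Γ_{J⋆}(g_q K g_q⁻¹)` (★ `arithmeticLevel`); (F3) `recip`: Shimura reciprocity ([Milne2005ShimuraVarieties] (62) p. 114)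
at every CM pair — for `σ ∈ Aut(ℂ/τL)` and a finite idèle `s` with `art_L(s) = σ|_{L^{ab}}` (★ `IsArtinCorrespondent`), an
`L`-rational vector `w ∈ L²` negative at `τ` (the special point `[τ w] ∈ 𝔻`) and the twist `d` (`IsDiagTwistGS`: `c(s)/s` on `w`,
`1` on `w^⊥`, ★ `recipFactor`), `σ • [τw, aK] = [τw, d·aK]` ([Deligne1979ShimuraVarieties] 2.2.4 with footnote 44).  Nothing is
asserted by the structure; NO existence fact is stated in this file.
[cite: Deligne1979ShimuraVarieties, 2.1.2, 2.2.4–2.2.5 (PDF p. 29 of Milne's translation)]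
[cite: Milne2005ShimuraVarieties, Def. 12.8 with (62) p. 114; Lemma 5.13 p. 57] [cite: Liu2021, §C.1 (FJcycle.tex l. 4575–4599), Rem. C.2, App. D l. 5355] -/
structure RecordGS where
  /-- (F1) the carrier: an `L`-scheme (the model over the reflex field `τ(L)`, pulled back along `τ`). -/
  M : SchemeOver L
  /-- (F1) `M → Spec L` is smooth of relative dimension `1` ([Liu2021] App. D l. 5355 «smooth curves over `E`»). -/
  smooth : AlgebraicGeometry.SmoothOfRelativeDimension 1 M.hom
  /-- (F1) `M` is projective over `L` (Compact Case: `J⋆` anisotropic). -/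
  projective : IsProjectiveOver M
  /-- (F2a) the complex points of `M` along `τ`, with their analytic topology, are `Sh_K(ℂ)`. -/
  pts : letI : Algebra L ℂ := τ.toAlgebra
    ComplexPoints M ≃ₜ ShimuraSetGS L Jstar τ K
  /-- (F2b) for every `a ∈ U(J⋆)(𝔸_f)` the map `v ↦ [v, aK]` on the negative cone of `J⋆^τ`, read in the COMPLEX curve
  `M_τ = M ⊗_{L,τ} ℂ` (`Motives.baseChangeHom τ`, points transported by `AlgPoints.baseChangeEquiv τ M`), is holomorphic in every
  algebraic coordinate of `M_τ` (`u` is pinned on `negCone (J⋆.map τ)`; elsewhere junk, as for `UnitaryBallUniformisationDatum.unif`). -/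
  hol : letI : Algebra L ℂ := τ.toAlgebra
    ∀ a : ↥(finAdelic (↥(maximalRealSubfield L)) L (IsCMField.complexConj L) 2 Jstar), ∃ u : (Fin 2 → ℂ) → ComplexPoints ((Motives.baseChangeHom τ).obj M),
      (∀ (v : Fin 2 → ℂ) (hv : v ∈ negCone (Jstar.map τ)),
          u v = AlgPoints.baseChangeEquiv τ M (pts.symm (ShimuraSetGS.mk L Jstar τ K v hv a))) ∧
        ∀ (U : ((Motives.baseChangeHom τ).obj M).left.affineOpens)
          (f : ((Motives.baseChangeHom τ).obj M).left.presheaf.obj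
            (Opposite.op (↑U : ((Motives.baseChangeHom τ).obj M).left.Opens))),
          DifferentiableOn ℂ
            (fun v ↦ AlgPoints.evalOrZero (↑U : ((Motives.baseChangeHom τ).obj M).left.Opens) f (u v))
            (negCone (Jstar.map τ) ∩ u ⁻¹' {P | P.pt ∈ (↑U : ((Motives.baseChangeHom τ).obj M).left.Opens)})
  /-- (F2c) the PIECES: `M_τ` is a colimit cofan in `SchemeOver ℂ`, indexed by `U(J⋆)(L⁺) \ U(J⋆)(𝔸_f) / K` through
  representatives `g_q`, of compact disc quotients of the tree's kind — each piece `X_q` carries a `UnitaryBallUniformisationDatum 1`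
  whose complex hermitian matrix is `J⋆^τ`, whose group read in `GL₂(ℂ)` is `τ(Γ_{J⋆}(g_q K g_q⁻¹))` (★ `arithmeticLevel`) and
  whose uniformisation is `v ↦ [v, g_q K]` ([Deligne1979ShimuraVarieties] 2.1.2; [Milne2005ShimuraVarieties] Lemma 5.13). -/
  pieces : letI : Algebra L ℂ := τ.toAlgebra
    ∃ (g : orbitRel.Quotient ↥(rational (↥(maximalRealSubfield L)) L (IsCMField.complexConj L) 2 Jstar)
          (CosetSpace (rationalToFinAdelic (↥(maximalRealSubfield L)) L (IsCMField.complexConj L) 2 Jstar) K) →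
        ↥(finAdelic (↥(maximalRealSubfield L)) L (IsCMField.complexConj L) 2 Jstar))
      (_ : ∀ q, Quotient.mk'' (CosetSpace.pt (rationalToFinAdelic (↥(maximalRealSubfield L)) L (IsCMField.complexConj L) 2 Jstar) K (g q)) = q)
      (X : orbitRel.Quotient ↥(rational (↥(maximalRealSubfield L)) L (IsCMField.complexConj L) 2 Jstar)
          (CosetSpace (rationalToFinAdelic (↥(maximalRealSubfield L)) L (IsCMField.complexConj L) 2 Jstar) K) → SchemeOver ℂ)
      (ι : ∀ q, X q ⟶ (Motives.baseChangeHom τ).obj M)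
      (_ : Limits.IsColimit (Limits.Cofan.mk ((Motives.baseChangeHom τ).obj M) ι))
      (B : ∀ q, UnitaryBallUniformisationDatum 1 (X q)),
      ∀ q, (B q).Hℂ = Jstar.map τ ∧
        (B q).Γ.map (Matrix.GeneralLinearGroup.map ((B q).τ₁ : ↥(B q).E →+* ℂ)) =
          (arithmeticLevel (↥(maximalRealSubfield L)) L (IsCMField.complexConj L) 2 Jstar
            (K.map (MulAut.conj (g q)).toMonoidHom)).map
            (Matrix.GeneralLinearGroup.map τ) ∧
        ∀ (v : Fin 2 → ℂ) (hv : v ∈ negCone (Jstar.map τ)),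
          AlgPoints.map (ι q) ((B q).unif v) =
            AlgPoints.baseChangeEquiv τ M (pts.symm (ShimuraSetGS.mk L Jstar τ K v hv (g q)))
  /-- (F3) Shimura reciprocity at the CM pairs: `σ • [τw, aK] = [τw, d·aK]`. -/
  recip : letI : Algebra L ℂ := τ.toAlgebra
    ∀ (σ : ℂ ≃ₐ[L] ℂ) (s : (FiniteAdeleRing (𝓞 L) L)ˣ),
      IsArtinCorrespondent L τ s σ.toRingEquiv →
      ∀ (w : Fin 2 → L) (hw : (fun i => τ (w i)) ∈ negCone (Jstar.map τ))
        (d : finAdelic (↥(maximalRealSubfield L)) L (IsCMField.complexConj L) 2 Jstar),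
        IsDiagTwistGS L Jstar w (recipFactor L s) d →
        ∀ a : ↥(finAdelic (↥(maximalRealSubfield L)) L (IsCMField.complexConj L) 2 Jstar),
          σ • pts.symm (ShimuraSetGS.mk L Jstar τ K (fun i => τ (w i)) hw a) =
            pts.symm (ShimuraSetGS.mk L Jstar τ K (fun i => τ (w i)) hw (d * a))

end Record

/-- **The canonical model of the unitary Shimura curve as a projective system** `K ↦ M_K` on the open compact `K ≤ K₀` of
`U(J⋆)(𝔸_{L⁺,f})` ([Deligne1979ShimuraVarieties] 2.1.2 «for `K` variable … the `_K M_ℂ` form a projective system», 2.1.4, 2.2.5;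
[Milne2005ShimuraVarieties] Def. 12.10 (a); [Liu2021] l. 4597–4599 and Prop. C.5 «projective system of schemes … indexed by sufficiently
small open compact subgroups `K`»), typed as a FUNCTOR out of `C5.SmallLevel K₀` (inclusions only) with the fields of `RecordGS` at
every level and the action of the transition morphisms on complex points `[v, aK] ↦ [v, aK']` (2.1.4).  No Hecke operators.  The rank-2
copy of the rank-3 `UnitaryCanonicalModel.RecordSystem`.  Nothing is asserted by the structure.
[cite: Deligne1979ShimuraVarieties, 2.1.2–2.1.4 and 2.2.5] [cite: Milne2005ShimuraVarieties, Def. 12.10 p. 115; Def. 12.8 p. 114]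
[cite: Liu2021, §C.1 l. 4597–4599 and Prop. C.5] -/
structure RecordSystemGS (K₀ : C5.OpenCompactSubgroup ↥(finAdelic (↥(maximalRealSubfield L)) L (IsCMField.complexConj L) 2 Jstar)) where
  /-- the models `M_K`, `K ≤ K₀` open compact, with their transition morphisms (a functor on the inclusion preorder). -/
  M : C5.SmallLevel K₀ ⥤ SchemeOver L
  /-- (F1) every `M_K → Spec L` is smooth of relative dimension `1`. -/
  smooth : ∀ K : C5.SmallLevel K₀, AlgebraicGeometry.SmoothOfRelativeDimension 1 (M.obj K).hom
  /-- (F1) every `M_K` is projective over `L`. -/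
  projective : ∀ K : C5.SmallLevel K₀, IsProjectiveOver (M.obj K)
  /-- (F2a) the complex points of `M_K` along `τ` are `Sh_K(ℂ)`. -/
  pts : letI : Algebra L ℂ := τ.toAlgebra
    ∀ K : C5.SmallLevel K₀, ComplexPoints (M.obj K) ≃ₜ ShimuraSetGS L Jstar τ K.1.1
  /-- the transition morphism `M_K → M_{K'}` (`K ≤ K'`) is `[v, aK] ↦ [v, aK']` on complex points
  ([Deligne1979ShimuraVarieties] 2.1.4). -/
  map_pts : letI : Algebra L ℂ := τ.toAlgebra
    ∀ (K K' : C5.SmallLevel K₀) (f : K ⟶ K') (v : Fin 2 → ℂ) (hv : v ∈ negCone (Jstar.map τ))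
      (a : ↥(finAdelic (↥(maximalRealSubfield L)) L (IsCMField.complexConj L) 2 Jstar)),
      pts K' (AlgPoints.map (M.map f) ((pts K).symm (ShimuraSetGS.mk L Jstar τ K.1.1 v hv a))) =
        ShimuraSetGS.mk L Jstar τ K'.1.1 v hv a
  /-- (F2b) at every level, `v ↦ [v, aK]` is holomorphic on the negative cone of `J⋆^τ`, in the algebraic coordinates of the
  complex curve `(M_K)_τ = M_K ⊗_{L,τ} ℂ`. -/
  hol : letI : Algebra L ℂ := τ.toAlgebra
    ∀ (K : C5.SmallLevel K₀) (a : ↥(finAdelic (↥(maximalRealSubfield L)) L (IsCMField.complexConj L) 2 Jstar)),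
      ∃ u : (Fin 2 → ℂ) → ComplexPoints ((Motives.baseChangeHom τ).obj (M.obj K)),
        (∀ (v : Fin 2 → ℂ) (hv : v ∈ negCone (Jstar.map τ)),
            u v = AlgPoints.baseChangeEquiv τ (M.obj K) ((pts K).symm (ShimuraSetGS.mk L Jstar τ K.1.1 v hv a))) ∧
          ∀ (U : ((Motives.baseChangeHom τ).obj (M.obj K)).left.affineOpens)
            (f : ((Motives.baseChangeHom τ).obj (M.obj K)).left.presheaf.obj
              (Opposite.op (↑U : ((Motives.baseChangeHom τ).obj (M.obj K)).left.Opens))),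
            DifferentiableOn ℂ
              (fun v ↦ AlgPoints.evalOrZero
                (↑U : ((Motives.baseChangeHom τ).obj (M.obj K)).left.Opens) f (u v))
              (negCone (Jstar.map τ) ∩
                u ⁻¹' {P | P.pt ∈ (↑U : ((Motives.baseChangeHom τ).obj (M.obj K)).left.Opens)})
  /-- (F2c) at every level, the pieces of `(M_K)_τ`: a cofan colimit of disc quotients of the tree's kind
  (`UnitaryBallUniformisationDatum 1`) by the natural levels `Γ_{J⋆}(g_q K g_q⁻¹)`, uniformised by `v ↦ [v, g_q K]`. -/
  pieces : letI : Algebra L ℂ := τ.toAlgebra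
    ∀ K : C5.SmallLevel K₀,
    ∃ (g : orbitRel.Quotient ↥(rational (↥(maximalRealSubfield L)) L (IsCMField.complexConj L) 2 Jstar)
          (CosetSpace (rationalToFinAdelic (↥(maximalRealSubfield L)) L (IsCMField.complexConj L) 2 Jstar) K.1.1) →
        ↥(finAdelic (↥(maximalRealSubfield L)) L (IsCMField.complexConj L) 2 Jstar))
      (_ : ∀ q, Quotient.mk'' (CosetSpace.pt (rationalToFinAdelic (↥(maximalRealSubfield L)) L (IsCMField.complexConj L) 2 Jstar) K.1.1 (g q)) = q)
      (X : orbitRel.Quotient ↥(rational (↥(maximalRealSubfield L)) L (IsCMField.complexConj L) 2 Jstar)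
          (CosetSpace (rationalToFinAdelic (↥(maximalRealSubfield L)) L (IsCMField.complexConj L) 2 Jstar) K.1.1) →
        SchemeOver ℂ)
      (ι : ∀ q, X q ⟶ (Motives.baseChangeHom τ).obj (M.obj K))
      (_ : Limits.IsColimit (Limits.Cofan.mk ((Motives.baseChangeHom τ).obj (M.obj K)) ι))
      (B : ∀ q, UnitaryBallUniformisationDatum 1 (X q)),
      ∀ q, (B q).Hℂ = Jstar.map τ ∧
        (B q).Γ.map (Matrix.GeneralLinearGroup.map ((B q).τ₁ : ↥(B q).E →+* ℂ)) =
          (arithmeticLevel (↥(maximalRealSubfield L)) L (IsCMField.complexConj L) 2 Jstar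
            (K.1.1.map (MulAut.conj (g q)).toMonoidHom)).map
            (Matrix.GeneralLinearGroup.map τ) ∧
        ∀ (v : Fin 2 → ℂ) (hv : v ∈ negCone (Jstar.map τ)),
          AlgPoints.map (ι q) ((B q).unif v) =
            AlgPoints.baseChangeEquiv τ (M.obj K) ((pts K).symm (ShimuraSetGS.mk L Jstar τ K.1.1 v hv (g q)))
  /-- (F3) at every level, Shimura reciprocity at the CM pairs: `σ • [τw, aK] = [τw, d·aK]`. -/
  recip : letI : Algebra L ℂ := τ.toAlgebra
    ∀ (K : C5.SmallLevel K₀) (σ : ℂ ≃ₐ[L] ℂ) (s : (FiniteAdeleRing (𝓞 L) L)ˣ),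
      IsArtinCorrespondent L τ s σ.toRingEquiv →
      ∀ (w : Fin 2 → L) (hw : (fun i => τ (w i)) ∈ negCone (Jstar.map τ))
        (d : finAdelic (↥(maximalRealSubfield L)) L (IsCMField.complexConj L) 2 Jstar),
        IsDiagTwistGS L Jstar w (recipFactor L s) d →
        ∀ a : ↥(finAdelic (↥(maximalRealSubfield L)) L (IsCMField.complexConj L) 2 Jstar),
          σ • (pts K).symm (ShimuraSetGS.mk L Jstar τ K.1.1 (fun i => τ (w i)) hw a) =
            (pts K).symm (ShimuraSetGS.mk L Jstar τ K.1.1 (fun i => τ (w i)) hw (d * a))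

/-- The record at ONE level `K ≤ K₀` of a system. [cite: Deligne1979ShimuraVarieties, 2.2.5] -/
def RecordSystemGS.record {K₀ : C5.OpenCompactSubgroup ↥(finAdelic (↥(maximalRealSubfield L)) L (IsCMField.complexConj L) 2 Jstar)}
    (S : RecordSystemGS L Jstar τ K₀) (K : C5.SmallLevel K₀) : RecordGS L Jstar τ K.1.1 where
  M := S.M.obj K
  smooth := S.smooth K
  projective := S.projective K
  pts := S.pts K
  hol := S.hol K
  pieces := S.pieces K
  recip := S.recip K

/-! ### §5. The sub-datum `U(J⋆) ↪ U(H)`: `φ = R_B ∘ blockdiag ∘ (·, 1)` on finite-adelic points (the pin's `φ`, literally) -/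

section Phi

variable (Jperp : Matrix (Fin 1) (Fin 1) L) (H : Matrix (Fin 3) (Fin 3) L) (B : GL (Fin 3) L) {a : L} (ha : a ≠ 0)
  (hB : formCongr ((IsCMField.complexConj L : L ≃ₐ[↥(maximalRealSubfield L)] L) : L →+* L) B (a • H) =
    finSum 2 1 Jstar Jperp)

/-- **`φ := R_B ∘ blockdiag ∘ (·, 1) : U(J⋆)(𝔸_f) → U(J⋆)(𝔸_f) × U(J⊥)(𝔸_f) → U(J⋆ ⊕ J⊥)(𝔸_f) → U(H)(𝔸_f)`**, `u ↦ R_B(u ⊕ 1)`,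
for a totally positive `J⊥ ∈ M₁(L)` and a frame `B ∈ GL₃(L)` with `ᵗ(cB)·(a·H)·B = J⋆ ⊕ J⊥` (★ `finAdelicBlockDiag`, ★ `finAdelicCongr`):
the finite-adelic points of the inclusion `U(V⋆) ↪ U(V)` through `V = V⋆ ⊕ V⋆^⊥` of [Liu2021] Thm. 4.15 (l. 2193–2203, `G⋆ ↪ G`
acting as the identity on `V⋆^⊥`), i.e. the homomorphism the seesaw-source PIN of the `a3_liu418` skeleton prescribes
(`φ (eG.symm u) = finAdelicCongr B _ hB (finAdelicBlockDiag 2 1 J⋆ J⊥ (u, 1))` with `eG = refl`; `a := 1` there).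
[cite: Liu2021, Thm. 4.15 proof (FJcycle.tex l. 2193–2203)] [cite: Kudla1984, §1] [cite: PlatonovRapinchuk1994, §2.3] -/
def φGS : ↥(finAdelic (↥(maximalRealSubfield L)) L (IsCMField.complexConj L) 2 Jstar) →* ↥(finAdelic (↥(maximalRealSubfield L)) L (IsCMField.complexConj L) 3 H) :=
  (finAdelicCongr (↥(maximalRealSubfield L)) L (IsCMField.complexConj L) B ha hB).toMonoidHom.comp
    ((finAdelicBlockDiag (↥(maximalRealSubfield L)) L (IsCMField.complexConj L) 2 1 Jstar Jperp).comp
      (MonoidHom.inl _ _))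

/-- `φGS` on elements: `R_B (u ⊕ 1)`. [cite: Liu2021, Thm. 4.15 proof (FJcycle.tex l. 2193–2203)] -/
theorem φGS_apply (u : ↥(finAdelic (↥(maximalRealSubfield L)) L (IsCMField.complexConj L) 2 Jstar)) :
    φGS L Jstar Jperp H B ha hB u =
      finAdelicCongr (↥(maximalRealSubfield L)) L (IsCMField.complexConj L) B ha hB
        (finAdelicBlockDiag (↥(maximalRealSubfield L)) L (IsCMField.complexConj L) 2 1 Jstar Jperp (u, 1)) :=
  rfl

/-- `φGS` is continuous. [cite: PlatonovRapinchuk1994, §2.3 and §5.1] -/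
theorem continuous_φGS : Continuous (φGS L Jstar Jperp H B ha hB) :=
  (finAdelicCongr (↥(maximalRealSubfield L)) L (IsCMField.complexConj L) B ha hB).continuous.comp
    ((continuous_finAdelicBlockDiag (↥(maximalRealSubfield L)) L (IsCMField.complexConj L) 2 1 Jstar Jperp).comp
      (continuous_id.prodMk continuous_const))

end Phi

/-! ### §6. Bookkeeping: `U(J⋆)(L⁺)` preserves the negative cone; the `U(J⋆)(L⁺) × ℂˣ`-action on the cone (for the dissection) -/

/-- Every complex embedding `τ` intertwines the CM involution (as the coerced algebra equivalence `c`) with complex conjugation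
(plumbing for `conjTranspose_ratToGLℂ_mul`). [folklore] -/
private theorem embedding_coe_complexConj (x : L) :
    τ (((IsCMField.complexConj L : L ≃ₐ[↥(maximalRealSubfield L)] L) : L →+* L) x) = starRingEnd ℂ (τ x) :=
  embedding_cmConjRingHom L τ x

/-- **`U(J⋆)(L⁺)` acts on `V⋆ ⊗_{L,τ} ℂ` by isometries of `J⋆^τ`**: `(γ^τ)ᴴ J⋆^τ γ^τ = J⋆^τ` (apply `τ` to `ᵗ(cγ) J⋆ γ = J⋆`).
[cite: BergeronMillsonMoeglin2016Balls, Part 2 §1.2] -/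
theorem conjTranspose_ratToGLℂ_mul (γ : ↥(rational (↥(maximalRealSubfield L)) L (IsCMField.complexConj L) 2 Jstar)) :
    (((ratToGLℂ L Jstar τ γ : GL (Fin 2) ℂ) : Matrix (Fin 2) (Fin 2) ℂ))ᴴ * Jstar.map τ *
        ((ratToGLℂ L Jstar τ γ : GL (Fin 2) ℂ) : Matrix (Fin 2) (Fin 2) ℂ) = Jstar.map τ := by
  have hγ := mem_unitaryGroupOfForm_iff.1 γ.2
  have h := congrArg (fun N : Matrix (Fin 2) (Fin 2) L => N.map τ) hγ
  simp only [Matrix.map_mul] at h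
  have ht : ((((γ : ↥(rational (↥(maximalRealSubfield L)) L (IsCMField.complexConj L) 2 Jstar)) : GL (Fin 2) L) :
        Matrix (Fin 2) (Fin 2) L).map ((IsCMField.complexConj L : L ≃ₐ[↥(maximalRealSubfield L)] L) : L →+* L))ᵀ.map τ =
      (((ratToGLℂ L Jstar τ γ : GL (Fin 2) ℂ) : Matrix (Fin 2) (Fin 2) ℂ))ᴴ := by
    ext i j
    simp only [coe_ratToGLℂ, Matrix.map_apply, transpose_apply, conjTranspose_apply, Complex.star_def,
      embedding_coe_complexConj]
  rw [ht] at h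
  rw [coe_ratToGLℂ]
  exact h

/-- **`U(J⋆)(L⁺)` and `ℂˣ` preserve the negative cone of `J⋆^τ`** (so they act on the disc `𝔻`): `c · γ^τ v` is negative when
`v` is. [cite: BergeronMillsonMoeglin2016Balls, Part 2 §1.3] -/
theorem smul_ratToGLℂ_mulVec_mem_negCone (γ : ↥(rational (↥(maximalRealSubfield L)) L (IsCMField.complexConj L) 2 Jstar)) {c : ℂ} (hc : c ≠ 0) {v : Fin 2 → ℂ}
    (hv : v ∈ negCone (Jstar.map τ)) :
    c • (((ratToGLℂ L Jstar τ γ : GL (Fin 2) ℂ) : Matrix (Fin 2) (Fin 2) ℂ) *ᵥ v) ∈ negCone (Jstar.map τ) := by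
  refine smul_mem_negCone hc ?_
  have hu := conjTranspose_ratToGLℂ_mul L Jstar τ γ
  change (star ((((ratToGLℂ L Jstar τ γ : GL (Fin 2) ℂ) : Matrix (Fin 2) (Fin 2) ℂ)) *ᵥ v) ⬝ᵥ
    (Jstar.map τ *ᵥ ((((ratToGLℂ L Jstar τ γ : GL (Fin 2) ℂ) : Matrix (Fin 2) (Fin 2) ℂ)) *ᵥ v))).re < 0
  rw [star_mulVec, mulVec_mulVec, dotProduct_mulVec, vecMul_vecMul, ← Matrix.mul_assoc, hu, ← dotProduct_mulVec]
  exact hv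

/-- The action map of `U(J⋆)(L⁺) × ℂˣ` on the negative cone: `(γ, c) · v = c · γ^τ v`. [cite: Milne2005ShimuraVarieties, §5 (5.1) p. 56] -/
def coneAct (p : ↥(rational (↥(maximalRealSubfield L)) L (IsCMField.complexConj L) 2 Jstar) × ℂˣ) (v : ↥(negCone (Jstar.map τ))) : ↥(negCone (Jstar.map τ)) :=
  ⟨(p.2 : ℂ) • (((ratToGLℂ L Jstar τ p.1 : GL (Fin 2) ℂ) : Matrix (Fin 2) (Fin 2) ℂ) *ᵥ (v : Fin 2 → ℂ)),
    smul_ratToGLℂ_mulVec_mem_negCone L Jstar τ p.1 p.2.ne_zero v.2⟩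

/-- `coneAct` on vectors. [cite: Milne2005ShimuraVarieties, §5 (5.1) p. 56] -/
@[simp] theorem coe_coneAct (p : ↥(rational (↥(maximalRealSubfield L)) L (IsCMField.complexConj L) 2 Jstar) × ℂˣ) (v : ↥(negCone (Jstar.map τ))) :
    ((coneAct L Jstar τ p v : ↥(negCone (Jstar.map τ))) : Fin 2 → ℂ) =
      (p.2 : ℂ) • (((ratToGLℂ L Jstar τ p.1 : GL (Fin 2) ℂ) : Matrix (Fin 2) (Fin 2) ℂ) *ᵥ (v : Fin 2 → ℂ)) :=
  rfl

/-- `coneAct 1 = id`. [cite: Milne2005ShimuraVarieties, §5 (5.1) p. 56] -/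
theorem coneAct_one (v : ↥(negCone (Jstar.map τ))) : coneAct L Jstar τ 1 v = v :=
  Subtype.ext (by rw [coe_coneAct, Prod.snd_one, Prod.fst_one, map_one, Units.val_one, Units.val_one,
    Matrix.one_mulVec, one_smul])

/-- `coneAct (p q) = coneAct p ∘ coneAct q`. [cite: Milne2005ShimuraVarieties, §5 (5.1) p. 56] -/
theorem coneAct_mul (p q : ↥(rational (↥(maximalRealSubfield L)) L (IsCMField.complexConj L) 2 Jstar) × ℂˣ) (v : ↥(negCone (Jstar.map τ))) :
    coneAct L Jstar τ (p * q) v = coneAct L Jstar τ p (coneAct L Jstar τ q v) :=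
  Subtype.ext (by
    rw [coe_coneAct, coe_coneAct, coe_coneAct, Prod.fst_mul, Prod.snd_mul, map_mul, Units.val_mul, Units.val_mul,
      Matrix.mulVec_smul, Matrix.mulVec_mulVec, smul_smul])

/-- **The action of `U(J⋆)(L⁺) × ℂˣ` on the negative cone of `J⋆^τ`, packaged as a `MulAction` STRUCTURE** (a definition,
deliberately NOT an instance: a consumer binds it with `letI := coneActionGS …` where the tree's generic `ShimuraDissection`
is wanted; the orbit relation of the induced action on `negCone × CosetSpace` is `gsRel` with the scalar made a unit).
[cite: Milne2005ShimuraVarieties, §5 (5.1) p. 56 and Lemma 5.13 p. 57] -/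
@[reducible] def coneActionGS : MulAction (↥(rational (↥(maximalRealSubfield L)) L (IsCMField.complexConj L) 2 Jstar) × ℂˣ) ↥(negCone (Jstar.map τ)) where
  smul := coneAct L Jstar τ
  one_smul := coneAct_one L Jstar τ
  mul_smul := coneAct_mul L Jstar τ

end UnitaryCanonicalModel

end Literature.AlgebraicGeometry.ShimuraVarieties

end
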